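import Summits.Ventures.WeilGRH.UniformConductorFloorJointFloorsLog9
import Summits.Ventures.WeilGRH.UniformConductorFloorJointEvenLog10Check
import Summits.Ventures.WeilGRH.UniformConductorFloorJointEvenLog10CheckB
import Summits.Ventures.WeilGRH.UniformConductorFloorJointOddLog10Check
import Summits.Ventures.WeilGRH.UniformConductorFloorJointOddLog10CheckB
import Summits.Ventures.WeilGRH.UniformConductorFloorCellsOne
import Summits.Ventures.WeilGRH.UniformConductorFloorRungs
import HarnessLib

/-!
# GRH arm (rh-explicit, venture WeilGRH): ★ the rung `t = (log 10)/2` for EVERY Dirichlet character of EVERY modulus `q ≥ 176` (odd characters: `q ≥ 62`) — the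
  joint cell certificates

Cell `rh-explicit`, WEIL TRACK — GRH ARM (weil-grh-1, gen9).  The uniform conductor floor at the fourth rung `t = (log 10)/2` (prime powers `2, 3, 4, 5, 7, 8, 9` inside
the window), from `certEvenLog10` / `certOddLog10` (`UniformConductorFloorJointDataLog10.lean`; `R = 320`, `J = 368`, `t = 368 log(320/319) = 1.151801 ≥ (log 10)/2`, `N = 10` — the window overshoots `e^{2t} = 10.01`, so the table is padded by the weight `0` at `10`),
kernel-checked in `…Joint{Even,Odd}Log10Check(B).lean`, through `JointCert.weilPositivityOnChar_of_parts`: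

* ★ `weilPositivityOnChar_log10half_of_ge_176` — EVERY Dirichlet character of EVERY modulus `q ≥ 176` satisfies `WeilPositivityOnChar χ ((log 10)/2)`;
* ★ `weilPositivityOnChar_log10half_of_odd_ge_62` — every ODD character of every modulus `q ≥ 62`.

With the flat-window failures at this rung (`UniformConductorFloorPrincipalLog10.lean`: every prime `p ≤ 163`) the PRIME statement at `(log 10)/2` reads «`p ≤ 163` fails, `p ≥ 179`
holds», the primes `167` (flat `164.59`, 32-mode Galerkin bottom `167.12` — expected FALSE by a table-based witness) and `173` (expected TRUE, a door cell of margin ≈ `0.03`) being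
open.  Inputs: the standard weights padded to `N = 10` (`hw_of_weights10`, `Λ(10) = 0`), `psi_even_ge` / `psi_odd_ge`, `log 176 ≥ 6 log 2 + log 3 − 16/176`, `log 62 ≥ 6 log 2 − 2/62`, and
`10·319^736 ≤ 320^736` for the window.  Method floors 174.37 / 61.62; no `ζ` input; standard axioms.

## References

* A. Weil (1952), (11) pp. 261–262 and the «lemme» p. 262 [Weil1952FormulesExplicites]; L. Collatz (1942) / H. Wielandt (1950). [folklore]
-/

noncomputable section

open Real Set
open scoped ArithmeticFunction.vonMangoldt

namespace Summit.Ventures.WeilGRH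

open Literature.NumberTheory.LFunctions

namespace UniformFloor

variable {q : ℕ}

/-! ## Inputs -/

/-- The weights of a `JointCert` with the standard table padded to `N = 10` (weight `0` at the non-prime-power `10`) dominate `Λ(n)/√n`. [folklore] -/
theorem hw_of_weights10 (c : JointCert) (hN : c.N = 10) (hD : c.D = 1048576)
    (hW : c.weights = [0, 0, 513950, 665112, 363409, 754726, 0, 771213, 256975, 383993, 0]) :
    ∀ n ∈ Finset.range (c.N + 1), (Λ n : ℝ) / Real.sqrt n ≤ c.wbar n := by
  intro n hn
  rw [hN] at hn
  have hn11 : n < 11 := by simpa using Finset.mem_range.1 hn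
  unfold JointCert.wbar
  rw [hD, hW]
  have h7 : ∀ m < 8, (Λ m : ℝ) / Real.sqrt m ≤ wbar7 m := fun m hm ↦
    wbar7_ge 7 le_rfl m (Finset.mem_range.2 (by omega))
  interval_cases n
  · exact (h7 0 (by norm_num)).trans (by norm_num [wbar7])
  · exact (h7 1 (by norm_num)).trans (by norm_num [wbar7])
  · exact (h7 2 (by norm_num)).trans (by norm_num [wbar7])
  · exact (h7 3 (by norm_num)).trans (by norm_num [wbar7])
  · exact (h7 4 (by norm_num)).trans (by norm_num [wbar7])
  · exact (h7 5 (by norm_num)).trans (by norm_num [wbar7])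
  · exact (h7 6 (by norm_num)).trans (by norm_num [wbar7])
  · exact (h7 7 (by norm_num)).trans (by norm_num [wbar7])
  · simpa using vonMangoldt_eight_div_sqrt_le
  · simpa using vonMangoldt_nine_div_sqrt_le
  · have h10 : (Λ 10 : ℝ) = 0 := by
      rw [ArithmeticFunction.vonMangoldt_eq_zero_iff.mpr (by decide : ¬ IsPrimePow 10)]
    rw [h10]
    norm_num

/-- `(log 10)/2 ≤ 368 log(320/319)` (`10·319^736 ≤ 320^736`). [folklore] -/
theorem log10half_le_t (c : JointCert) (hR : c.R = 320) (hJ : c.J = 368) : Real.log 10 / 2 ≤ c.t := by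
  rw [JointCert.t_eq_log, hR, hJ]
  have h : Real.log 10 ≤ Real.log (((((320 : ℕ) : ℝ) / (((320 : ℕ) : ℝ) - 1)) ^ 368) ^ 2) := by
    refine Real.log_le_log (by norm_num) ?_
    rw [← pow_mul, div_pow, le_div_iff₀ (by norm_num)]
    have h0 : (10 : ℝ) * 319 ^ 736 ≤ 320 ^ 736 := by exact_mod_cast (by decide +kernel : 10 * 319 ^ 736 ≤ 320 ^ 736)
    norm_num
    exact h0
  rw [Real.log_pow] at h
  push_cast at h ⊢
  linarith

/-- The budget of `certEvenLog10`: `log π − (−4.22745354) − Clow/D + RHO/D = 5.161184 ≤ log 176` (`log 176 ≥ 6 log 2 + log 3 − 16/176 = 5.166586`).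
[folklore] -/
theorem certEvenLog10_budget :
    Real.log Real.pi - (-4.22745354) - (certEvenLog10.Clow : ℝ) / certEvenLog10.D + (certEvenLog10.RHO : ℝ) / certEvenLog10.D ≤ Real.log (176 : ℕ) := by
  have hπ := Literature.Analysis.SpecialFunctions.Real.log_pi_le
  have h2 := Real.log_two_gt_d9
  have h3 := Real.log_three_gt_d9
  have hl : Real.log ((192 : ℝ) / 176) ≤ 192 / 176 - 1 := Real.log_le_sub_one_of_pos (by norm_num)
  have hS : Real.log (192 : ℝ) = 6 * Real.log 2 + 1 * Real.log 3 := by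
    rw [show (192 : ℝ) = 2 ^ 6 * 3 ^ 1 by norm_num, Real.log_mul (by norm_num) (by norm_num), Real.log_pow, Real.log_pow]
    push_cast
    ring
  rw [Real.log_div (by norm_num) (by norm_num), hS] at hl
  rw [show certEvenLog10.Clow = 7676641 from rfl, show certEvenLog10.D = 1048576 from rfl, show certEvenLog10.RHO = 7455392 from rfl]
  push_cast at *
  linarith

/-- The budget of `certOddLog10`: `… = 4.120906 ≤ log 62` (`log 62 ≥ 6 log 2 − 2/62 = 4.126625`). [folklore] -/
theorem certOddLog10_budget :
    Real.log Real.pi - (-1.08586154) - (certOddLog10.Clow : ℝ) / certOddLog10.D + (certOddLog10.RHO : ℝ) / certOddLog10.D ≤ Real.log (62 : ℕ) := by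
  have hπ := Literature.Analysis.SpecialFunctions.Real.log_pi_le
  have h2 := Real.log_two_gt_d9
  have hl : Real.log ((64 : ℝ) / 62) ≤ 64 / 62 - 1 := Real.log_le_sub_one_of_pos (by norm_num)
  have hS : Real.log (64 : ℝ) = 6 * Real.log 2 := by
    rw [show (64 : ℝ) = 2 ^ 6 by norm_num, Real.log_pow]
    push_cast
    ring
  rw [Real.log_div (by norm_num) (by norm_num), hS] at hl
  rw [show certOddLog10.Clow = 4399981 from rfl, show certOddLog10.D = 1048576 from rfl, show certOddLog10.RHO = 6382119 from rfl]
  push_cast at *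
  linarith

/-! ## The cells, reassembled from the two kernel ranges -/

/-- All `368` cells of `certEvenLog10`. [folklore] -/
theorem certEvenLog10_cells : ∀ j < certEvenLog10.J, certEvenLog10.cellOKB j = true := by
  intro j hj
  have hJ : certEvenLog10.J = 368 := rfl
  by_cases h : j < 184
  · exact certEvenLog10.cellsLoop_spec 184 0 (by omega) certEvenLog10_cellsA j (Nat.zero_le _) (by omega)
  · exact certEvenLog10.cellsLoop_spec 184 184 (by omega) certEvenLog10_cellsB j (by omega) (by omega)

/-- All `368` cells of `certOddLog10`. [folklore] -/
theorem certOddLog10_cells : ∀ j < certOddLog10.J, certOddLog10.cellOKB j = true := by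
  intro j hj
  have hJ : certOddLog10.J = 368 := rfl
  by_cases h : j < 184
  · exact certOddLog10.cellsLoop_spec 184 0 (by omega) certOddLog10_cellsA j (Nat.zero_le _) (by omega)
  · exact certOddLog10.cellsLoop_spec 184 184 (by omega) certOddLog10_cellsB j (by omega) (by omega)

/-! ## The floors -/

/-- ★ Every EVEN character of every modulus `q ≥ 176` at the rung `(log 10)/2`. [folklore] -/
theorem weilPositivityOnChar_log10half_of_even_ge_176 (hq : 176 ≤ q) (χ : DirichletCharacter ℂ q) (hpar : charParity χ = 0) :
    WeilPositivityOnChar χ (Real.log 10 / 2) := by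
  have h := certEvenLog10.weilPositivityOnChar_of_parts certEvenLog10_checkFrame certEvenLog10_cells
    (hw_of_weights10 certEvenLog10 rfl rfl rfl) psi_even_ge (Q₀ := 176) (by norm_num) certEvenLog10_budget (by omega) hq χ hpar
  have ht := log10half_le_t certEvenLog10 rfl rfl
  exact fun g hg hsupp ↦ h g hg (hsupp.trans (Icc_subset_Icc (by linarith) ht))

/-- ★ Every ODD character of every modulus `q ≥ 62` at the rung `(log 10)/2`. [cite: Weil1952FormulesExplicites, (11) and the «lemme» p. 262] -/
theorem weilPositivityOnChar_log10half_of_odd_ge_62 (hq : 62 ≤ q) (χ : DirichletCharacter ℂ q) (hpar : charParity χ = 1) :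
    WeilPositivityOnChar χ (Real.log 10 / 2) := by
  have h := certOddLog10.weilPositivityOnChar_of_parts certOddLog10_checkFrame certOddLog10_cells
    (hw_of_weights10 certOddLog10 rfl rfl rfl) psi_odd_ge (Q₀ := 62) (by norm_num) certOddLog10_budget (by omega) hq χ hpar
  have ht := log10half_le_t certOddLog10 rfl rfl
  exact fun g hg hsupp ↦ h g hg (hsupp.trans (Icc_subset_Icc (by linarith) ht))

/-- ★★ **EVERY Dirichlet character of EVERY modulus `q ≥ 176` satisfies Weil positivity on `[−(log 10)/2, (log 10)/2]`.**
[cite: Weil1952FormulesExplicites, (11) and the «lemme» p. 262] -/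
theorem weilPositivityOnChar_log10half_of_ge_176 (hq : 176 ≤ q) (χ : DirichletCharacter ℂ q) : WeilPositivityOnChar χ (Real.log 10 / 2) := by
  rcases Nat.le_one_iff_eq_zero_or_eq_one.1 (charParity_le_one χ) with h | h
  · exact weilPositivityOnChar_log10half_of_even_ge_176 hq χ h
  · exact weilPositivityOnChar_log10half_of_odd_ge_62 (by omega) χ h

/-- The same on every window `t ≤ (log 10)/2`. [folklore] -/
theorem weilPositivityOnChar_of_le_log10half_of_ge_176 (hq : 176 ≤ q) (χ : DirichletCharacter ℂ q) {t : ℝ} (ht : t ≤ Real.log 10 / 2) :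
    WeilPositivityOnChar χ t := fun g hg hsupp ↦
  weilPositivityOnChar_log10half_of_ge_176 hq χ g hg (hsupp.trans (Icc_subset_Icc (by linarith) ht))

end UniformFloor

end Summit.Ventures.WeilGRH

end
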